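import Literature.Computability.Complexity.NegationLimited
import Literature.Computability.Complexity.CircuitSemantics
import Mathlib.Data.Nat.Log
import HarnessLib

/-!
# Markov's theorem, lower bound: discharge of `markov_lower`

This file DISCHARGES the named fact `Literature.Computability.Complexity.markov_lower`
(`NegationLimited.lean`; Markov 1957/58; Jukna 2012, §10.2, Theorem 10.5 with Lemma 10.7
"`d(f) ≤ 2^{I(f)} - 1`", book p. 290): every circuit over `{∧₂, ∨₂, ¬}` computing `f` has at
least `⌈log₂ (d(f)+1)⌉` NOT gates — `markov_lower_holds`. Everything here is PROVED over the
straight-line circuits of `Circuit.lean` and the gate-by-gate semantics (`transcript`,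
`getD_transcript_eq_gateValue`) of `CircuitSemantics.lean`.

Proof architecture. Jukna proves Lemma 10.7 by induction on the number of NOT gates, splitting
off a first NOT gate `f(x) = g(¬h(x), x)` with `h` monotone and cutting an optimal chain `Y` into
the two segments on which `h` is constant (`d_Y(f) ≤ d_{Y₀}(f) + d_{Y₁}(f) + 1`). We run the same
argument as an invariant along the straight-line program instead of performing circuit surgery
(the tree's De Morgan basis has no constant gates to substitute for `¬h`):

* `Markov.Agree C j x y`: the inputs `x, y` give the same value to every NOT gate of index `< j`.
  On `Agree C (m+1)`-related inputs `x ≤ y` the value of gate `m` is monotone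
  (`Markov.gateVal_mono`, induction on `m`: `∧`, `∨` are monotone, a NOT gate is frozen by the
  hypothesis), and a NOT gate `m` is antitone on `Agree C m`-related inputs
  (`Markov.gateVal_anti_of_isNot`).
* `Markov.breaks R l`: the number of consecutive pairs of the chain `l` NOT related by `R`
  (the number of cuts of the chain into `R`-blocks). Jump-down positions of `f` are cuts of
  `Agree C size` (`Markov.jumpsDown_le_breaks`), there are no cuts for `j = 0`, and passing a NOT
  gate at most doubles-plus-one the number of cuts (`Markov.breaks_and_succ_le`: inside a block the
  new NOT gate is antitone, hence changes its value at most once) — this is exactly Jukna's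
  `d_{Y₀} + d_{Y₁} + 1` step. Hence `breaks (Agree C j) l + 1 ≤ 2 ^ #{NOT gates < j}`
  (`Markov.breaks_agree_succ_le_two_pow`) and `d(f) + 1 ≤ 2 ^ negationCount C`
  (`Markov.decrease_succ_le_two_pow`), i.e. `⌈log₂ (d(f)+1)⌉ ≤ negationCount C`.

The argument only uses that every non-NOT gate computes a monotone function of its inputs
(`Markov.MonoGates`), so the bound is proved in that generality (unbounded fan-in `∧`/`∨`,
threshold gates, constants would all be admissible); `deMorganBasis` is the special case
`Markov.monoGates_of_isOver_deMorgan`.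

## References

* A. A. Markov, *On the inversion complexity of a system of functions*, J. ACM 5 (1958) 331–334
  [Markov1958].
* S. Jukna, *Boolean Function Complexity: Advances and Frontiers*, Springer (2012), §10.2,
  Theorem 10.5 and Lemma 10.7 (p. 290) [Jukna2012].
-/

namespace Literature.Computability.Complexity

open Finset

namespace Markov

variable {ι : Type*}

/-! ### Gate values and the agreement relation -/

/-- The value of gate `i` of the circuit `C` at input `x` (junk `false` for `i ≥ size`).
[cite: AroraBarak2009, Rem. 6.4] -/
def gateVal (C : Circuit ι) (x : ι → Bool) (i : ℕ) : Bool := (transcript x [] C.gates).getD i false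

/-- The gate equation: the value of gate `j` is its truth table applied to the values of its
argument wires. [cite: AroraBarak2009, Rem. 6.4] -/
theorem gateVal_eq (C : Circuit ι) (x : ι → Bool) {j : ℕ} (hj : j < C.gates.length) :
    gateVal C x j =
      (C.gates[j]).op fun a => wireVal x (transcript x [] C.gates) ((C.gates[j]).args a) :=
  getD_transcript_eq_gateValue C x j hj

/-- Gate `i` of `C` exists and is a NOT gate. [folklore] -/
def IsNot (C : Circuit ι) (i : ℕ) : Prop := ∃ h : i < C.gates.length, (C.gates[i]).fn = GateFn.not

/-- `Agree C j x y`: the inputs `x` and `y` give the same value to every NOT gate of `C` of index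
`< j` (the blocks of a chain on which the first NOT gates are constant; Jukna 2012, proof of
Lemma 10.7). [folklore] -/
def Agree (C : Circuit ι) (j : ℕ) (x y : ι → Bool) : Prop :=
  ∀ i < j, IsNot C i → gateVal C x i = gateVal C y i

/-- `Agree` is antitone in the index. [folklore] -/
theorem Agree.mono {C : Circuit ι} {j j' : ℕ} (h : j ≤ j') {x y : ι → Bool}
    (ha : Agree C j' x y) : Agree C j x y :=
  fun i hi => ha i (lt_of_lt_of_le hi h)

/-- No condition at index `0`. [folklore] -/
theorem agree_zero (C : Circuit ι) (x y : ι → Bool) : Agree C 0 x y :=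
  fun i hi => absurd hi (Nat.not_lt_zero i)

/-- `Agree` at `j + 1` is `Agree` at `j` plus agreement at gate `j` if it is a NOT gate.
[folklore] -/
theorem agree_succ_iff {C : Circuit ι} {j : ℕ} {x y : ι → Bool} :
    Agree C (j + 1) x y ↔ Agree C j x y ∧ (IsNot C j → gateVal C x j = gateVal C y j) := by
  constructor
  · exact fun h => ⟨h.mono (Nat.le_succ j), h j (Nat.lt_succ_self j)⟩
  · rintro ⟨h1, h2⟩ i hi hN
    rcases Nat.lt_succ_iff_lt_or_eq.1 hi with hi | rfl
    · exact h1 i hi hN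
    · exact h2 hN

/-! ### Monotone gates, antitone NOT gates -/

/-- `MonoGates C`: every gate of `C` other than a NOT gate computes a monotone function of its
argument wires (true over `{∧₂, ∨₂, ¬}`). [folklore] -/
def MonoGates (C : Circuit ι) : Prop := ∀ g ∈ C.gates, g.fn ≠ GateFn.not → Monotone g.op

/-- Over the De Morgan basis `{∧₂, ∨₂, ¬}` every non-NOT gate is `∧₂` or `∨₂`, hence monotone.
[cite: Jukna2012, §1.2] -/
theorem monoGates_of_isOver_deMorgan {C : Circuit ι} (hC : C.IsOver deMorganBasis) :
    MonoGates C := by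
  intro g hg hne
  have h := hC g hg
  simp only [deMorganBasis, Set.mem_insert_iff, Set.mem_singleton_iff] at h
  rcases h with h | h | h
  · rcases g with ⟨k, op, args⟩
    simp only [Gate.fn, GateFn.and, Sigma.mk.injEq] at h
    obtain ⟨rfl, h⟩ := h
    obtain rfl := eq_of_heq h
    intro v w hvw
    show decide (∀ i, v i = true) ≤ decide (∀ i, w i = true)
    simp only [Bool.le_iff_imp, decide_eq_true_eq]
    exact fun hv i => Bool.le_iff_imp.1 (hvw i) (hv i)
  · rcases g with ⟨k, op, args⟩
    simp only [Gate.fn, GateFn.or, Sigma.mk.injEq] at h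
    obtain ⟨rfl, h⟩ := h
    obtain rfl := eq_of_heq h
    intro v w hvw
    show decide (∃ i, v i = true) ≤ decide (∃ i, w i = true)
    simp only [Bool.le_iff_imp, decide_eq_true_eq]
    exact fun ⟨i, hi⟩ => ⟨i, Bool.le_iff_imp.1 (hvw i) hi⟩
  · exact absurd h hne

/-- A NOT gate computes an antitone function of its argument wire. [folklore] -/
theorem antitone_op_of_fn_eq_not {g : Gate ι} (h : g.fn = GateFn.not) : Antitone g.op := by
  rcases g with ⟨k, op, args⟩
  simp only [Gate.fn, GateFn.not, Sigma.mk.injEq] at h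
  obtain ⟨rfl, h⟩ := h
  obtain rfl := eq_of_heq h
  intro v w hvw
  show (!(w 0)) ≤ (!(v 0))
  have h0 : v 0 ≤ w 0 := hvw 0
  revert h0
  generalize v 0 = a
  generalize w 0 = b
  revert a b
  decide

/-- **Monotonicity inside a block.** If every non-NOT gate is monotone, then on inputs `x ≤ y`
giving the same value to all NOT gates of index `≤ m`, the value of gate `m` is monotone.
(Jukna 2012, proof of Lemma 10.7: with the NOT gates frozen the circuit is monotone.)
[cite: Jukna2012, §10.2 Lemma 10.7 (proof)] -/
theorem gateVal_mono {C : Circuit ι} (hmono : MonoGates C) :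
    ∀ m : ℕ, m < C.gates.length → ∀ {x y : ι → Bool}, x ≤ y → Agree C (m + 1) x y →
      gateVal C x m ≤ gateVal C y m := by
  intro m
  induction m using Nat.strong_induction_on with
  | _ m ih =>
    intro hm x y hxy hA
    by_cases hN : (C.gates[m]).fn = GateFn.not
    · exact (hA m (Nat.lt_succ_self m) ⟨hm, hN⟩).le
    · rw [gateVal_eq C x hm, gateVal_eq C y hm]
      apply hmono _ (List.getElem_mem hm) hN
      intro a
      dsimp only
      cases ha : (C.gates[m]).args a with
      | inl i => exact hxy i
      | inr m' =>
        have hm' : m' < m := C.wf m hm a m' ha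
        exact ih m' hm' (hm'.trans hm) hxy (hA.mono (Nat.succ_le_succ hm'.le))

/-- **A NOT gate is antitone inside its block**: on inputs `x ≤ y` agreeing on all earlier NOT
gates, the value of the NOT gate `m` can only drop. (Jukna 2012, proof of Lemma 10.7: the input
`h` of the first NOT gate is monotone along the chain.)
[cite: Jukna2012, §10.2 Lemma 10.7 (proof)] -/
theorem gateVal_anti_of_isNot {C : Circuit ι} (hmono : MonoGates C) {m : ℕ}
    (hm : m < C.gates.length) (hN : (C.gates[m]).fn = GateFn.not) {x y : ι → Bool} (hxy : x ≤ y)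
    (hA : Agree C m x y) : gateVal C y m ≤ gateVal C x m := by
  rw [gateVal_eq C x hm, gateVal_eq C y hm]
  apply antitone_op_of_fn_eq_not hN
  intro a
  dsimp only
  cases ha : (C.gates[m]).args a with
  | inl i => exact hxy i
  | inr m' =>
    have hm' : m' < m := C.wf m hm a m' ha
    exact gateVal_mono hmono m' (hm'.trans hm) hxy (hA.mono (Nat.succ_le_of_lt hm'))

/-- The computed function is monotone on inputs agreeing on all NOT gates. [folklore] -/
theorem eval_mono {C : Circuit ι} (hmono : MonoGates C) {x y : ι → Bool} (hxy : x ≤ y)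
    (hA : Agree C C.gates.length x y) : C.eval x ≤ C.eval y := by
  rw [eval_eq_wireVal C x, eval_eq_wireVal C y]
  cases ho : C.output with
  | inl i => exact hxy i
  | inr m =>
    have hm := C.wf_output m ho
    exact gateVal_mono hmono m hm hxy (hA.mono (Nat.succ_le_of_lt hm))

/-! ### Cutting a chain into blocks -/

section breaks

variable {α : Type*}

open Classical in
/-- `breaks R l`: the number of consecutive pairs `(a, b)` of the list `l` with `¬ R a b`, i.e.
the number of cuts of `l` into maximal `R`-blocks. [folklore] -/
noncomputable def breaks (R : α → α → Prop) : List α → ℕ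
  | a :: b :: l => (if R a b then 0 else 1) + breaks R (b :: l)
  | _ => 0

/-- `breaks` of the empty list. [folklore] -/
@[simp] theorem breaks_nil (R : α → α → Prop) : breaks R [] = 0 := rfl

/-- `breaks` of a singleton. [folklore] -/
@[simp] theorem breaks_singleton (R : α → α → Prop) (a : α) : breaks R [a] = 0 := rfl

open Classical in
/-- `breaks` on `a :: b :: l`. [folklore] -/
theorem breaks_cons_cons (R : α → α → Prop) (a b : α) (l : List α) :
    breaks R (a :: b :: l) = (if R a b then 0 else 1) + breaks R (b :: l) := rfl

/-- A total relation has no cuts. [folklore] -/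
theorem breaks_eq_zero {R : α → α → Prop} (h : ∀ a b, R a b) : ∀ l : List α, breaks R l = 0
  | [] => rfl
  | [_] => rfl
  | a :: b :: l => by rw [breaks_cons_cons, if_pos (h a b), breaks_eq_zero h (b :: l)]

/-- A finer relation has at least as many cuts. [folklore] -/
theorem breaks_mono {R S : α → α → Prop} (h : ∀ a b, R a b → S a b) :
    ∀ l : List α, breaks S l ≤ breaks R l
  | [] => le_rfl
  | [_] => le_rfl
  | a :: b :: l => by
    have ih := breaks_mono h (b :: l)
    rw [breaks_cons_cons, breaks_cons_cons]
    by_cases hR : R a b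
    · rw [if_pos hR, if_pos (h a b hR)]
      simpa using ih
    · rw [if_neg hR]
      split <;> omega

/-- **Refining by an antitone bit at most doubles-plus-one the number of cuts** (with head
correction): if along `a :: l` the bit `v` can only drop inside an `R`-block, then the cuts of
`R ∧ (v = v)` number at most `2 · (cuts of R) + 1`, and one less if the chain starts with
`v = 0`. This is the step `d_Y(f) ≤ d_{Y₀}(f) + d_{Y₁}(f) + 1` of Jukna 2012, Lemma 10.7.
[cite: Jukna2012, §10.2 Lemma 10.7 (proof)] -/
theorem breaks_and_le (R : α → α → Prop) (v : α → Bool) :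
    ∀ (a : α) (l : List α), (a :: l).IsChain (fun a b => R a b → v b ≤ v a) →
      breaks (fun a b => R a b ∧ v a = v b) (a :: l) + (if v a = false then 1 else 0) ≤
        2 * breaks R (a :: l) + 1
  | a, [], _ => by
    rw [breaks_singleton, breaks_singleton]
    split <;> omega
  | a, b :: l, h => by
    rw [List.isChain_cons_cons] at h
    have ih := breaks_and_le R v b l h.2
    rw [breaks_cons_cons, breaks_cons_cons]
    by_cases hR : R a b
    · have hv : v b = true → v a = true := Bool.le_iff_imp.1 (h.1 hR)
      cases hva : v a <;> cases hvb : v b <;> simp [hR, hva, hvb] at ih hv ⊢ <;> omega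
    · cases hva : v a <;> cases hvb : v b <;> simp [hR, hvb] at ih ⊢ <;> omega

/-- Refining by an antitone bit: `cuts' + 1 ≤ 2 (cuts + 1)`.
[cite: Jukna2012, §10.2 Lemma 10.7 (proof)] -/
theorem breaks_and_succ_le (R : α → α → Prop) (v : α → Bool) :
    ∀ l : List α, l.IsChain (fun a b => R a b → v b ≤ v a) →
      breaks (fun a b => R a b ∧ v a = v b) l + 1 ≤ 2 * (breaks R l + 1)
  | [], _ => by simp
  | a :: l, h => by
    have := breaks_and_le R v a l h
    split at this <;> omega

end breaks

/-- Jump-down positions of `f` are cuts of any relation inside whose blocks `f` is monotone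
along the chain. [folklore] -/
theorem jumpsDown_le_breaks {n : ℕ} (f : (Fin n → Bool) → Bool)
    (R : (Fin n → Bool) → (Fin n → Bool) → Prop) :
    ∀ l : List (Fin n → Bool), l.IsChain (fun a b => R a b → f a ≤ f b) →
      jumpsDown f l ≤ breaks R l
  | [], _ => by simp [jumpsDown]
  | [_], _ => by simp [jumpsDown]
  | a :: b :: l, h => by
    rw [List.isChain_cons_cons] at h
    have ih := jumpsDown_le_breaks f R (b :: l) h.2
    simp only [jumpsDown, breaks_cons_cons]
    by_cases hR : R a b
    · have hf : f a = true → f b = true := Bool.le_iff_imp.1 (h.1 hR)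
      have : ¬(f a = true ∧ f b = false) := fun ⟨h1, h2⟩ => by simpa [h2] using hf h1
      rw [if_neg this, if_pos hR]
      simpa using ih
    · rw [if_neg hR]
      split <;> omega

/-! ### Counting NOT gates along the program -/

/-- The number of NOT gates among the first `j` gates of `C`. [folklore] -/
noncomputable def notsBefore (C : Circuit ι) (j : ℕ) : ℕ :=
  ((C.gates.take j).map fun g => negWeight g.fn).sum

/-- No gates, no NOT gates. [folklore] -/
theorem notsBefore_zero (C : Circuit ι) : notsBefore C 0 = 0 := by simp [notsBefore]

/-- One more gate. [folklore] -/
theorem notsBefore_succ (C : Circuit ι) {j : ℕ} (hj : j < C.gates.length) :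
    notsBefore C (j + 1) = notsBefore C j + negWeight (C.gates[j]).fn := by
  rw [notsBefore, notsBefore, List.take_add_one, List.getElem?_eq_getElem hj]
  simp only [Option.toList_some, List.map_append, List.map_cons, List.map_nil, List.sum_append,
    List.sum_cons, List.sum_nil, add_zero]

/-- All gates: `notsBefore C size = negationCount C`. [folklore] -/
theorem notsBefore_length (C : Circuit ι) : notsBefore C C.gates.length = C.negationCount := by
  simp [notsBefore, Circuit.negationCount_eq, Circuit.sizeWith]

/-- `negWeight` of a NOT gate function. [folklore] -/
theorem negWeight_eq_one {g : GateFn} (h : g = GateFn.not) : negWeight g = 1 := by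
  subst h; exact negWeight_not

/-- `negWeight` of a non-NOT gate function. [folklore] -/
theorem negWeight_eq_zero {g : GateFn} (h : g ≠ GateFn.not) : negWeight g = 0 := by
  simp [negWeight, h]

/-! ### The invariant and Markov's bound -/

/-- **The invariant.** Along a strictly increasing chain `l` of the cube, the number of cuts into
blocks on which the NOT gates of index `< j` are constant is less than `2 ^ #{NOT gates < j}`.
(Jukna 2012, Lemma 10.7, induction unrolled along the program.)
[cite: Jukna2012, §10.2 Lemma 10.7] -/
theorem breaks_agree_succ_le_two_pow {n : ℕ} (C : Circuit (Fin n)) (hmono : MonoGates C)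
    {l : List (Fin n → Bool)} (hl : l.IsChain (· < ·)) :
    ∀ j ≤ C.gates.length, breaks (Agree C j) l + 1 ≤ 2 ^ notsBefore C j := by
  intro j
  induction j with
  | zero =>
    intro
    rw [notsBefore_zero, pow_zero, breaks_eq_zero (agree_zero C) l]
    omega
  | succ j ih =>
    intro hj
    have hj' : j < C.gates.length := hj
    have ih := ih hj'.le
    rw [notsBefore_succ C hj']
    by_cases hN : (C.gates[j]).fn = GateFn.not
    · have h1 : breaks (Agree C (j + 1)) l ≤
          breaks (fun a b => Agree C j a b ∧ gateVal C a j = gateVal C b j) l :=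
        breaks_mono (fun a b h => agree_succ_iff.2 ⟨h.1, fun _ => h.2⟩) l
      have hchain : l.IsChain (fun a b => Agree C j a b → gateVal C b j ≤ gateVal C a j) :=
        hl.imp fun a b hab hA => gateVal_anti_of_isNot hmono hj' hN hab.le hA
      have h2 := breaks_and_succ_le (Agree C j) (fun a => gateVal C a j) l hchain
      rw [negWeight_eq_one hN, pow_succ]
      omega
    · have h1 : breaks (Agree C (j + 1)) l ≤ breaks (Agree C j) l :=
        breaks_mono (fun a b h => agree_succ_iff.2 ⟨h, fun ⟨_, h2⟩ => absurd h2 hN⟩) l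
      rw [negWeight_eq_zero hN, add_zero]
      omega

/-- **Markov's bound along one chain**: a circuit with monotone non-NOT gates computing `f`
has `d_Y(f) + 1 ≤ 2 ^ #NOT` for every chain `Y`. [cite: Jukna2012, §10.2 Lemma 10.7] -/
theorem jumpsDown_succ_le_two_pow {n : ℕ} (C : Circuit (Fin n)) (hmono : MonoGates C)
    {f : (Fin n → Bool) → Bool} (hf : C.Computes f) {l : List (Fin n → Bool)}
    (hl : l.IsChain (· < ·)) : jumpsDown f l + 1 ≤ 2 ^ C.negationCount := by
  have hchain : l.IsChain (fun a b => Agree C C.gates.length a b → f a ≤ f b) :=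
    hl.imp fun a b hab hA => by rw [← hf a, ← hf b]; exact eval_mono hmono hab.le hA
  have h1 := jumpsDown_le_breaks f _ l hchain
  have h2 := breaks_agree_succ_le_two_pow C hmono hl C.gates.length le_rfl
  rw [notsBefore_length] at h2
  omega

/-- **Markov's theorem, Lemma 10.7 as printed** (for circuits with monotone non-NOT gates):
`d(f) ≤ 2 ^ #NOT - 1`. [cite: Jukna2012, §10.2 Lemma 10.7] -/
theorem decrease_le_two_pow_sub_one {n : ℕ} (C : Circuit (Fin n)) (hmono : MonoGates C)
    {f : (Fin n → Bool) → Bool} (hf : C.Computes f) : decrease f ≤ 2 ^ C.negationCount - 1 := by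
  refine csSup_le ⟨0, [], List.IsChain.nil, rfl⟩ ?_
  rintro _ ⟨l, hl, rfl⟩
  have := jumpsDown_succ_le_two_pow C hmono hf hl
  omega

/-- `d(f) + 1 ≤ 2 ^ #NOT` (no truncated subtraction). [cite: Jukna2012, §10.2 Lemma 10.7] -/
theorem decrease_succ_le_two_pow {n : ℕ} (C : Circuit (Fin n)) (hmono : MonoGates C)
    {f : (Fin n → Bool) → Bool} (hf : C.Computes f) : decrease f + 1 ≤ 2 ^ C.negationCount := by
  have h1 := decrease_le_two_pow_sub_one C hmono hf
  have h2 : 1 ≤ 2 ^ C.negationCount := Nat.one_le_two_pow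
  omega

end Markov

/-- **Markov's theorem, lower bound** (Markov 1957/58; Jukna 2012, §10.2, Theorem 10.5 with
Lemma 10.7 `d(f) ≤ 2^{I(f)} - 1`), discharging the named fact `markov_lower`: every circuit
over `{∧₂, ∨₂, ¬}` computing `f` has at least `⌈log₂ (d(f)+1)⌉` NOT gates.
[cite: Jukna2012, §10.2 Thm. 10.5 / Lemma 10.7] -/
theorem markov_lower_holds : markov_lower := fun _ _ C hB hf =>
  Nat.clog_le_of_le_pow
    (Markov.decrease_succ_le_two_pow C (Markov.monoGates_of_isOver_deMorgan hB) hf)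

end Literature.Computability.Complexity
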